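import Literature.Geometry.Manifold.SmoothSingularChains
import Literature.AlgebraicTopology.SingularHomology.SubsetCohomologyMayerVietoris
import Literature.Algebra.Homology.HomologySequenceTauOne
import HarnessLib

/-!
# Smooth singular cochains of open subsets: small chains and the Mayer–Vietoris sequence

Second brick of the integration proof of **de Rham's theorem** (Bredon, *Topology and Geometry*
(1993), §V.9; Lee (2013), Thm. 18.7 / 18.14): the cohomology theory
`U ↦ H•(Hom_R(Δ_•^{smooth}(U), N))` of *smooth* singular cochains of the open subsets `U` of a
manifold `M`, computed inside the concrete singular chain complex `C(M)` of
`…SingularHomology.SingularChainsConcrete` exactly as the tree computes ordinary subset cochains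
(`…SingularHomology.subsetCochains`, `SubsetCochains.lean`, `SubsetCohomologyMayerVietoris.lean`).

* `isIso_homologyMap_incl_of_subdivision`: Hatcher's Prop. 2.21 ("small chains compute
  homology") for an arbitrary pair of subcomplexes `S' ≤ S` of `C(M)` stable under the
  subdivision homotopies `Dⱼ`, such that every chain of `S` becomes `S'`-small under iterated
  subdivision (the tree's proof, `…isIso_homologyMap_incl_smallSub_of_subdivision`, verbatim);
* `isIso_homologyMap_incl_smoothSup`: for `U`, `V` open,
  `Δ^{sm}(U) + Δ^{sm}(V) ↪ Δ^{sm}(U ∪ V)` is a quasi-isomorphism (Bredon (1993), §V.9, the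
  smooth case of Thm. IV.17.7: subdivision of a smooth simplex is smooth);
* `smoothSubsetCochains I R N M U = Hom_R(Δ_•^{smooth}(U), N)` with restrictions `res`, the
  comparison `toSmooth U : Hom(C(U), N) → Hom(Δ^{sm}(U), N)` (restriction of cochains to smooth
  chains, Bredon's `Δ*(U) → Δ*_{smooth}(U)`; natural in `U`), the Mayer–Vietoris short exact
  sequence `mvShortComplex` of smooth cochains and its comparison morphism `mvToSmooth` from the
  Mayer–Vietoris sequence of all cochains (a morphism of short exact sequences, the input of the
  five-lemma ladder `Literature.Algebra.Homology.isIso_homologyMap_τ₁_of_forall`).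

Everything is proved; no named facts.

## References

* G. E. Bredon, *Topology and Geometry*, GTM 139 (1993), §IV.17, §V.9 (Lemma V.9.4, Thm. V.9.5).
* A. Hatcher, *Algebraic Topology* (2002), Prop. 2.21, §3.1 p. 204.
* J. M. Lee, *Introduction to Smooth Manifolds*, 2nd ed. (2013), Thm. 18.7, Thm. 18.14.
-/

noncomputable section

-- see "Implementation notes" in `…SingularHomology.SingularChainsConcrete`
set_option backward.isDefEq.respectTransparency false

open CategoryTheory Limits Set Literature.AlgebraicTopology.SingularHomology

universe u v

namespace Literature.Geometry.Manifold

/-! ### Small chains compute homology: two subcomplexes stable under subdivision -/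

section SmallChains

variable (R : Type v) [CommRing R] (A : Type v) [AddCommGroup A] [Module R A]
variable {X : Type u} [TopologicalSpace X]

/-- **Hatcher Prop. 2.21 for a pair of subcomplexes.** Let `S' ≤ S` be subcomplexes of the concrete
singular chain complex `C(X; A)` both stable under the subdivision chain homotopies
`Dⱼ = ∑_{i<j} T Sⁱ`, and assume every chain of `S` becomes a chain of `S'` after some iterated
barycentric subdivision `Sʲ`. Then `S' ↪ S` induces isomorphisms on all homology groups. The
proof is the tree's `isIso_homologyMap_incl_smallSub_of_subdivision` verbatim (`∂Dⱼ + Dⱼ∂ = 𝟙 - Sʲ`).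
[cite: HatcherAT2002, Prop. 2.21] -/
theorem isIso_homologyMap_incl_of_subdivision {S' S : Subcomplex (csingularChainComplex R A X)}
    (hle : S' ≤ S)
    (hS' : ∀ (n j : ℕ) (c : CChain A X n), c ∈ S' n → sdhSum R A j n c ∈ S' (n + 1))
    (hS : ∀ (n j : ℕ) (c : CChain A X n), c ∈ S n → sdhSum R A j n c ∈ S (n + 1))
    (hsmall : ∀ (n : ℕ) (c : CChain A X n), c ∈ S n → ∃ j : ℕ, ((sdX R A n) ^ j) c ∈ S' n)
    (k : ℕ) :
    IsIso (HomologicalComplex.homologyMap (Subcomplex.incl hle) k) := by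
  -- `∂ (Dⱼ z) = z - Sʲ z` for a cycle `z` (in every degree)
  have hD : ∀ (k j : ℕ) (zc : CChain A X k), (∀ k', k = k' + 1 → ∀ (h : k = k' + 1),
      csingularChainComplex.bd R k' (h ▸ zc) = 0) →
      csingularChainComplex.bd R k (sdhSum R A j k zc) + ((sdX R A k) ^ j) zc = zc := by
    intro k j zc hzc
    cases k with
    | zero => rw [bd_sdhSum_zero, sdX_pow_zero_apply, zero_add]
    | succ k =>
      have h := bd_sdhSum_add_sdhSum_bd (R := R) (M := A) j zc
      rw [hzc k rfl rfl, map_zero, add_zero] at h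
      rw [h, sub_add_cancel]
  rw [ConcreteCategory.isIso_iff_bijective]
  constructor
  · -- injectivity: an `S'`-cycle bounding in `S` bounds in `S'`
    refine (homologyMap_injective_iff _).mpr fun z hz hb => ?_
    rw [exists_d_prev_eq_iff (ChainComplex.prev ℕ k)] at hb ⊢
    obtain ⟨w, hw⟩ := hb
    set zc : CChain A X k := z.1 with hzc
    set wc : CChain A X (k + 1) := w.1 with hwc
    have hw' : csingularChainComplex.bd R k wc = zc := by
      rw [hwc, hzc, ← toComplex_d_val, hw]
      rfl
    have hcyc : ∀ k', k = k' + 1 → ∀ (h : k = k' + 1), csingularChainComplex.bd R k' (h ▸ zc) = 0 := by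
      rintro k' rfl h
      rw [d_next_eq_zero_iff (ChainComplex.next_nat_succ k')] at hz
      rw [hzc, ← toComplex_d_val, hz]
      rfl
    obtain ⟨j, hj⟩ := hsmall _ wc w.2
    refine ⟨⟨((sdX R A (k + 1)) ^ j) wc + sdhSum R A j k zc,
      Submodule.add_mem _ hj (hS' _ j _ z.2)⟩, Subtype.ext ?_⟩
    rw [toComplex_d_val]
    change csingularChainComplex.bd R k (((sdX R A (k + 1)) ^ j) wc + sdhSum R A j k zc) = zc
    rw [map_add, ← sdX_pow_bd, hw', add_comm, hD k j zc hcyc]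
  · -- surjectivity: every cycle of `S` is homologous to an `S'`-cycle
    refine (homologyMap_surjective_iff _).mpr fun z hz => ?_
    set zc : CChain A X k := z.1 with hzc
    have hcyc : ∀ k', k = k' + 1 → ∀ (h : k = k' + 1), csingularChainComplex.bd R k' (h ▸ zc) = 0 := by
      rintro k' rfl h
      rw [d_next_eq_zero_iff (ChainComplex.next_nat_succ k')] at hz
      rw [hzc, ← toComplex_d_val, hz]
      rfl
    obtain ⟨j, hj⟩ := hsmall _ zc z.2
    refine ⟨⟨((sdX R A k) ^ j) zc, hj⟩, ?_, ?_⟩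
    · -- `Sʲ z` is a cycle
      cases k with
      | zero => exact toComplex_d_zero_next R A _ _
      | succ k =>
        rw [d_next_eq_zero_iff (ChainComplex.next_nat_succ k)]
        apply Subtype.ext
        rw [toComplex_d_val]
        change csingularChainComplex.bd R k (((sdX R A (k + 1)) ^ j) zc) = 0
        rw [← sdX_pow_bd, hcyc k rfl rfl, map_zero]
    · rw [exists_d_prev_eq_iff (ChainComplex.prev ℕ k)]
      refine ⟨⟨sdhSum R A j k zc, hS _ j _ z.2⟩, Subtype.ext ?_⟩
      rw [toComplex_d_val]
      change csingularChainComplex.bd R k (sdhSum R A j k zc) = zc - ((sdX R A k) ^ j) zc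
      rw [eq_sub_iff_add_eq, hD k j zc hcyc]

end SmallChains

/-! ### Smooth small chains -/

section SmoothSmall

variable {E : Type*} [NormedAddCommGroup E] [NormedSpace ℝ E]
  {H : Type*} [TopologicalSpace H] (I : ModelWithCorners ℝ E H)
  (R : Type v) [CommRing R] (A : Type v) [AddCommGroup A] [Module R A]
  {M : Type u} [TopologicalSpace M] [ChartedSpace H M]

/-- `Dⱼ` preserves smooth chains with image in `U`. [cite: Bredon1993, §V.9] -/
theorem sdhSum_mem_smoothChainsInSub (U : Set M) (n j : ℕ) (c : CChain A M n)
    (hc : c ∈ smoothChainsInSub I R A M U n) : sdhSum R A j n c ∈ smoothChainsInSub I R A M U (n + 1) :=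
  ⟨sdhSum_mem_smoothChains j hc.1, sdhSum_mem_chainsIn j hc.2⟩

/-- `Δ^{sm}(U) ⊔ Δ^{sm}(V)` in a degree is `Finsupp.supported` on the smooth simplices with image
in `U` or in `V`. [folklore] -/
theorem smoothChainsInSub_sup_apply (U V : Set M) (n : ℕ) :
    (smoothChainsInSub I R A M U ⊔ smoothChainsInSub I R A M V) n =
      Finsupp.supported A R (smoothSimplices I M n ∩ (simplicesIn M U n ∪ simplicesIn M V n)) := by
  change smoothChains I R A M n ⊓ chainsIn R A M U n ⊔ smoothChains I R A M n ⊓ chainsIn R A M V n = _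
  rw [smoothChains, chainsIn, chainsIn, ← Finsupp.supported_inter, ← Finsupp.supported_inter,
    ← Finsupp.supported_union, ← inter_union_distrib_left]

/-- `Δ^{sm}(U) ⊔ Δ^{sm}(V) = Δ^{sm}(M) ⊓ (C(U) ⊔ C(V))`: a smooth `{U, V}`-small chain is a sum of
a smooth chain in `U` and a smooth chain in `V`. [folklore] -/
theorem smoothChainsInSub_sup_eq (U V : Set M) :
    smoothChainsInSub I R A M U ⊔ smoothChainsInSub I R A M V =
      smoothSub I R A M ⊓ (chainsInSub R A M U ⊔ chainsInSub R A M V) := by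
  refine Subcomplex.ext fun n => ?_
  rw [smoothChainsInSub_sup_apply]
  change _ = smoothChains I R A M n ⊓ (chainsIn R A M U n ⊔ chainsIn R A M V n)
  rw [smoothChains, chainsIn, chainsIn, ← Finsupp.supported_union, ← Finsupp.supported_inter]

/-- `Dⱼ` preserves `Δ^{sm}(U) ⊔ Δ^{sm}(V)`. [cite: Bredon1993, §V.9] -/
theorem sdhSum_mem_smoothChainsInSub_sup (U V : Set M) (n j : ℕ) (c : CChain A M n)
    (hc : c ∈ (smoothChainsInSub I R A M U ⊔ smoothChainsInSub I R A M V) n) :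
    sdhSum R A j n c ∈ (smoothChainsInSub I R A M U ⊔ smoothChainsInSub I R A M V) (n + 1) := by
  rw [smoothChainsInSub_sup_eq] at hc ⊢
  refine ⟨sdhSum_mem_smoothChains j hc.1, ?_⟩
  have h := sdhSum_mem_smallChains R A (fun b : Bool => cond b U V) j
    (c := c) (by rw [← smallSub_apply, smallSub_bool]; exact hc.2)
  rw [← smallSub_apply, smallSub_bool] at h
  exact h

/-- **Smooth small chains compute smooth homology**: for `U`, `V` open,
`Δ^{sm}(U) + Δ^{sm}(V) ↪ Δ^{sm}(U ∪ V)` induces isomorphisms on all homology groups — iterated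
barycentric subdivision makes every chain `{U, V}`-small and keeps smooth chains smooth
(Bredon (1993), §V.9, proof of Thm. V.9.5 via Thm. IV.17.7; Lee (2013), proof of Thm. 18.7).
[cite: Bredon1993, §V.9] -/
theorem isIso_homologyMap_incl_smoothSup {U V : Set M} (hU : IsOpen U) (hV : IsOpen V) (k : ℕ) :
    IsIso (HomologicalComplex.homologyMap
      (Subcomplex.incl (smoothChainsInSub_sup_le (I := I) (R := R) (A := A) U V)) k) := by
  refine isIso_homologyMap_incl_of_subdivision R A _
    (fun n j c hc => sdhSum_mem_smoothChainsInSub_sup I R A U V n j c hc)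
    (fun n j c hc => sdhSum_mem_smoothChainsInSub I R A (U ∪ V) n j c hc) (fun n c hc => ?_) k
  have hUV : ∀ b : Bool, IsOpen (cond b U V) := fun b => by cases b <;> assumption
  have hc' : c ∈ chainsIn R A M (⋃ b : Bool, cond b U V) n :=
    chainsIn_mono R A (fun x hx => hx.elim (fun h => mem_iUnion.2 ⟨true, h⟩)
      (fun h => mem_iUnion.2 ⟨false, h⟩)) n hc.2
  obtain ⟨j, hj⟩ := exists_sdX_pow_mem_smallChains R A _ hUV hc'
  refine ⟨j, ?_⟩
  rw [smoothChainsInSub_sup_eq]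
  refine ⟨sdX_pow_mem_smoothChains j hc.1, ?_⟩
  rw [← smallSub_apply, smallSub_bool] at hj
  exact hj

/-- The same, as a `QuasiIso` instance-able statement. [cite: Bredon1993, §V.9] -/
theorem quasiIso_incl_smoothSup {U V : Set M} (hU : IsOpen U) (hV : IsOpen V) :
    QuasiIso (Subcomplex.incl (smoothChainsInSub_sup_le (I := I) (R := R) (A := A) U V)) :=
  ⟨fun k => by
    rw [quasiIsoAt_iff_isIso_homologyMap]
    exact isIso_homologyMap_incl_smoothSup I R A hU hV k⟩

/-! ### Freeness of the smooth chain modules -/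

/-- The module `Δₙ^{sm}(U)` is free (on the smooth simplices with image in `U`). [folklore] -/
instance free_smoothChainsInSub (U : Set M) (n : ℕ) :
    Module.Free R ↥(smoothChainsInSub I R R M U n) := by
  change Module.Free R ↥(smoothChains I R R M n ⊓ chainsIn R R M U n)
  rw [smoothChains, chainsIn, ← Finsupp.supported_inter]
  exact free_supported R _

/-- The module `(Δ^{sm}(U) + Δ^{sm}(V))ₙ` is free. [folklore] -/
instance free_smoothChainsInSub_sup (U V : Set M) (n : ℕ) :
    Module.Free R ↥((smoothChainsInSub I R R M U ⊔ smoothChainsInSub I R R M V) n) := by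
  rw [smoothChainsInSub_sup_apply]
  exact free_supported R _

/-- The chain modules of `Δ^{sm}(U)` are projective objects of `ModuleCat R`. [folklore] -/
instance projective_smoothChainsInSub_X (U : Set M) (n : ℕ) :
    Projective ((smoothChainsInSub I R R M U).toComplex.X n) := by
  haveI : Module.Projective R ↥(smoothChainsInSub I R R M U n) := Module.Projective.of_free
  exact ModuleCat.projective_of_categoryTheory_projective
    (ModuleCat.of R ↥(smoothChainsInSub I R R M U n))

/-- The chain modules of `Δ^{sm}(U) + Δ^{sm}(V)` are projective objects of `ModuleCat R`. [folklore] -/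
instance projective_smoothChainsInSub_sup_X (U V : Set M) (n : ℕ) :
    Projective ((smoothChainsInSub I R R M U ⊔ smoothChainsInSub I R R M V).toComplex.X n) := by
  haveI : Module.Projective R ↥((smoothChainsInSub I R R M U ⊔ smoothChainsInSub I R R M V) n) :=
    Module.Projective.of_free
  exact ModuleCat.projective_of_categoryTheory_projective
    (ModuleCat.of R ↥((smoothChainsInSub I R R M U ⊔ smoothChainsInSub I R R M V) n))

end SmoothSmall

/-! ### Smooth cochains of a subset, computed in `C(M)` -/

section Cochains

variable {E : Type*} [NormedAddCommGroup E] [NormedSpace ℝ E]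
  {H : Type*} [TopologicalSpace H] (I : ModelWithCorners ℝ E H)
  (R : Type v) [CommRing R] (N : ModuleCat.{max u v} R)
  (M : Type u) [TopologicalSpace M] [ChartedSpace H M]

/-- **The smooth singular cochains of `U ⊆ M` with values in `N`**, computed in `C(M)`:
the cochain complex `Hom_R(Δ_•^{smooth}(U), N)`, dual of the subcomplex of smooth chains with
image in `U` (Bredon (1993), §V.5 / §V.9, `Δ*_{smooth}(U; G)`; Lee (2013), p. 480,
`C^p_∞(U)`). [cite: Bredon1993, §V.9] -/
abbrev smoothSubsetCochains (U : Set M) :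
    HomologicalComplex (ModuleCat.{max u v} R) (ComplexShape.down ℕ).symm :=
  dualObj R N (smoothChainsInSub I R R M U).toComplex

namespace smoothSubsetCochains

variable {M}

/-- Restriction of smooth cochains along `U ⊆ V` (dual of `Δ^{sm}(U) ↪ Δ^{sm}(V)`). [cite: Bredon1993, §V.9] -/
abbrev res {U V : Set M} (h : U ⊆ V) :
    smoothSubsetCochains I R N M V ⟶ smoothSubsetCochains I R N M U :=
  dualMap R N (Subcomplex.incl (smoothChainsInSub_mono (I := I) (R := R) (A := R) h))

variable {I R N}

/-- Restriction along `U ⊆ U` is the identity. [folklore] -/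
@[simp] lemma res_refl (U : Set M) : res I R N (subset_refl U) = 𝟙 _ := by
  rw [res, Subcomplex.incl, Subcomplex.subMap_id, dualMap_id]

/-- Restrictions compose. [folklore] -/
@[reassoc]
lemma res_comp {U V W : Set M} (h : U ⊆ V) (h' : V ⊆ W) :
    res I R N (h.trans h') = res I R N h' ≫ res I R N h := by
  rw [res, res, res, ← dualMap_comp, Subcomplex.incl_comp_incl]

/-- Restriction does not depend on the proof of inclusion. [folklore] -/
lemma res_congr {U V : Set M} (h h' : U ⊆ V) : res I R N h = res I R N h' := rfl

variable (I R N)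

/-- **Restriction of cochains to smooth chains** `Hom(C(U), N) → Hom(Δ^{sm}(U), N)`: the dual of
the inclusion `Δ^{sm}(U) ≤ C(U)` (Bredon (1993), §V.9, the natural map `Δ* → Δ*_{smooth}` whose
bijectivity on cohomology is Thm. V.9.5). [cite: Bredon1993, §V.9] -/
abbrev toSmooth (U : Set M) : subsetCochains R N U ⟶ smoothSubsetCochains I R N M U :=
  dualMap R N (Subcomplex.incl (smoothChainsInSub_le_chainsInSub (I := I) (R := R) (A := R) U))

/-- `toSmooth` is natural for restrictions: `res ≫ toSmooth = toSmooth ≫ res`. [cite: Bredon1993, §V.9] -/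
@[reassoc]
theorem res_comp_toSmooth {U V : Set M} (h : U ⊆ V) :
    subsetCochains.res R N h ≫ toSmooth I R N U = toSmooth I R N V ≫ res I R N h := by
  rw [subsetCochains.res, toSmooth, toSmooth, res, ← dualMap_comp, ← dualMap_comp,
    Subcomplex.incl_comp_incl, Subcomplex.incl_comp_incl]

/-! ### Small smooth cochains -/

/-- Restriction `Hom(Δ^{sm}(U ∪ V), N) → Hom(Δ^{sm}(U) + Δ^{sm}(V), N)` to small smooth chains. [cite: Bredon1993, §V.9] -/
abbrev resSup (U V : Set M) :
    smoothSubsetCochains I R N M (U ∪ V) ⟶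
      dualObj R N (smoothChainsInSub I R R M U ⊔ smoothChainsInSub I R R M V).toComplex :=
  dualMap R N (Subcomplex.incl (smoothChainsInSub_sup_le (I := I) (R := R) (A := R) U V))

variable {I R N}

/-- **Restriction to small smooth cochains is a quasi-isomorphism** for `U`, `V` open (dual of
the quasi-isomorphism `Δ^{sm}(U) + Δ^{sm}(V) ↪ Δ^{sm}(U ∪ V)` between complexes of free modules).
[cite: Bredon1993, §V.9] -/
theorem isIso_homologyMap_resSup {U V : Set M} (hU : IsOpen U) (hV : IsOpen V) (p : ℕ) :
    IsIso (HomologicalComplex.homologyMap (resSup I R N U V) p) :=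
  haveI := quasiIso_incl_smoothSup I R R (M := M) hU hV
  isIso_homologyMap_dualMap_of_quasiIso _ p

/-- The cohomology of small smooth cochains is that of `U ∪ V` (`U`, `V` open). [cite: Bredon1993, §V.9] -/
def supHomologyIso {U V : Set M} (hU : IsOpen U) (hV : IsOpen V) (p : ℕ) :
    (dualObj R N (smoothChainsInSub I R R M U ⊔ smoothChainsInSub I R R M V).toComplex).homology p ≅
      (smoothSubsetCochains I R N M (U ∪ V)).homology p :=
  haveI := isIso_homologyMap_resSup (N := N) (I := I) hU hV p
  (asIso (HomologicalComplex.homologyMap (resSup I R N U V) p)).symm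

/-- `supHomologyIso⁻¹` is restriction to small smooth cochains on cohomology. [folklore] -/
@[simp] lemma supHomologyIso_inv {U V : Set M} (hU : IsOpen U) (hV : IsOpen V) (p : ℕ) :
    (supHomologyIso (I := I) (N := N) hU hV p).inv =
      HomologicalComplex.homologyMap (resSup I R N U V) p := rfl

variable (I R N)

/-- `Hom(Δ^{sm}(U) ⊓ Δ^{sm}(V), N) ≅ Hom(Δ^{sm}(U ∩ V), N)` (the subcomplexes are equal). [folklore] -/
def interIso (U V : Set M) :
    dualObj R N (smoothChainsInSub I R R M U ⊓ smoothChainsInSub I R R M V).toComplex ≅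
      smoothSubsetCochains I R N M (U ∩ V) :=
  haveI := Subcomplex.isIso_incl_of_eq (smoothChainsInSub_inter (I := I) (R := R) (A := R) U V (M := M))
  dualMapIso (asIso (Subcomplex.incl (smoothChainsInSub_inter (I := I) (R := R) (A := R) U V (M := M)).le))

/-- `interIso` is the dual of the inclusion `Δ^{sm}(U ∩ V) ≤ Δ^{sm}(U) ⊓ Δ^{sm}(V)`. [folklore] -/
lemma interIso_hom (U V : Set M) :
    (interIso I R N U V).hom =
      dualMap R N (Subcomplex.incl (smoothChainsInSub_inter (I := I) (R := R) (A := R) U V (M := M)).le) :=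
  rfl

/-- Compatibility of `interIso` with the left restriction. [folklore] -/
@[reassoc]
lemma dualMap_inf_le_left_comp_interIso_hom (U V : Set M) :
    dualMap R N (Subcomplex.incl
        (inf_le_left : smoothChainsInSub I R R M U ⊓ smoothChainsInSub I R R M V ≤ _)) ≫
      (interIso I R N U V).hom = res I R N (inter_subset_left : U ∩ V ⊆ U) := by
  rw [interIso_hom, res, ← dualMap_comp, Subcomplex.incl_comp_incl]

/-- Compatibility of `interIso` with the right restriction. [folklore] -/
@[reassoc]
lemma dualMap_inf_le_right_comp_interIso_hom (U V : Set M) :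
    dualMap R N (Subcomplex.incl
        (inf_le_right : smoothChainsInSub I R R M U ⊓ smoothChainsInSub I R R M V ≤ _)) ≫
      (interIso I R N U V).hom = res I R N (inter_subset_right : U ∩ V ⊆ V) := by
  rw [interIso_hom, res, ← dualMap_comp, Subcomplex.incl_comp_incl]

/-! ### The Mayer–Vietoris short exact sequence of smooth cochains -/

/-- Local notation: the subcomplex `Δ^{sm}(U) ⊆ C(M)`. -/
local notation "𝑆" U:arg => smoothChainsInSub I R R M U

/-- **The Mayer–Vietoris short complex of smooth cochain complexes**
`Hom(Δ^{sm}(U) + Δ^{sm}(V), N) → Hom(Δ^{sm}(U), N) ⊞ Hom(Δ^{sm}(V), N) → Hom(Δ^{sm}(U ∩ V), N)`,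
`ω ↦ (ω|, ω|)`, `(ψ, χ) ↦ ψ| - χ|` (Bredon (1993), §V.9, the smooth row of the Mayer–Vietoris
ladder; signs as in the tree's `subsetCochains.mvShortComplex`). [cite: Bredon1993, §V.9] -/
abbrev mvShortComplex (U V : Set M) :
    ShortComplex (HomologicalComplex (ModuleCat.{max u v} R) (ComplexShape.down ℕ).symm) where
  X₁ := dualObj R N (𝑆 U ⊔ 𝑆 V).toComplex
  X₂ := smoothSubsetCochains I R N M U ⊞ smoothSubsetCochains I R N M V
  X₃ := smoothSubsetCochains I R N M (U ∩ V)
  f := biprod.lift (dualMap R N (Subcomplex.incl (le_sup_left : 𝑆 U ≤ 𝑆 U ⊔ 𝑆 V)))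
    (dualMap R N (Subcomplex.incl (le_sup_right : 𝑆 V ≤ 𝑆 U ⊔ 𝑆 V)))
  g := biprod.desc (res I R N inter_subset_left) (-res I R N inter_subset_right)
  zero := by
    rw [biprod.lift_desc, Preadditive.comp_neg, res, res, ← dualMap_comp, ← dualMap_comp,
      Subcomplex.incl_comp_incl, Subcomplex.incl_comp_incl]
    exact add_neg_eq_zero.mpr rfl

/-- The Mayer–Vietoris short complex of smooth cochains is the `Hom`-dual of the Mayer–Vietoris
short exact sequence of chain subcomplexes `Subcomplex.mvSub (𝑆 U) (𝑆 V)`, up to the sign twist on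
the middle term and `interIso` on the third. [folklore] -/
def mvShortComplexIso (U V : Set M) :
    mvShortComplex I R N U V ≅ dualShortComplex (N := N) (Subcomplex.mvSub (𝑆 U) (𝑆 V)) :=
  ShortComplex.isoMk (S₁ := mvShortComplex I R N U V)
    (S₂ := dualShortComplex (N := N) (Subcomplex.mvSub (𝑆 U) (𝑆 V)))
    (Iso.refl _) (dualBiprodIsoTwist (𝑆 U).toComplex (𝑆 V).toComplex) (interIso I R N U V).symm
    (by
      change 𝟙 _ ≫ dualMap R N (Subcomplex.mvSubG (𝑆 U) (𝑆 V)) =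
        biprod.lift _ _ ≫ (dualBiprodIsoTwist _ _).hom
      rw [Category.id_comp, Subcomplex.mvSubG, biprod.desc_eq, dualMap_add, dualMap_comp,
        Preadditive.comp_neg, dualMap_neg, dualMap_comp, biprod.lift_eq, Preadditive.add_comp,
        Category.assoc, Category.assoc, inl_dualBiprodIsoTwist_hom, inr_dualBiprodIsoTwist_hom,
        Preadditive.comp_neg])
    (by
      change (dualBiprodIsoTwist _ _).hom ≫ dualMap R N (Subcomplex.mvSubF (𝑆 U) (𝑆 V)) =
        biprod.desc _ _ ≫ (interIso I R N U V).inv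
      rw [Iso.eq_comp_inv, Category.assoc]
      apply biprod.hom_ext'
      · rw [inl_dualBiprodIsoTwist_hom_assoc, ← dualMap_comp_assoc, Subcomplex.mvSubF,
          biprod.lift_fst, dualMap_inf_le_left_comp_interIso_hom, biprod.inl_desc]
      · rw [inr_dualBiprodIsoTwist_hom_assoc, Preadditive.neg_comp, ← dualMap_comp_assoc,
          Subcomplex.mvSubF, biprod.lift_snd, dualMap_inf_le_right_comp_interIso_hom,
          biprod.inr_desc])

/-- **The Mayer–Vietoris short complex of smooth cochains is short exact** (dual of a degreewise
split short exact sequence: `(Δ^{sm}(U) + Δ^{sm}(V))ₙ` is free). [cite: Bredon1993, §V.9] -/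
theorem mvShortComplex_shortExact (U V : Set M) : (mvShortComplex I R N U V).ShortExact := by
  haveI : ∀ i, Projective ((Subcomplex.mvSub (𝑆 U) (𝑆 V)).X₃.X i) :=
    fun i => projective_smoothChainsInSub_sup_X I R U V i
  exact (ShortComplex.shortExact_iff_of_iso (mvShortComplexIso I R N U V)).2
    (dualShortComplex_shortExact_of_projective _ (Subcomplex.mvSub_shortExact _ _))

/-- Homology of a biproduct map is an isomorphism when it is on both factors (homology commutes
with binary biproducts, `homologyBiprodIso`). [folklore] -/
theorem isIso_homologyMap_biprod_map
    {K L K' L' : HomologicalComplex (ModuleCat.{max u v} R) (ComplexShape.down ℕ).symm}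
    (f : K ⟶ K') (g : L ⟶ L') (i : ℕ) [IsIso (HomologicalComplex.homologyMap f i)]
    [IsIso (HomologicalComplex.homologyMap g i)] :
    IsIso (HomologicalComplex.homologyMap (biprod.map f g) i) := by
  have e : (homologyBiprodIso K L i).inv ≫ HomologicalComplex.homologyMap (biprod.map f g) i ≫
      (homologyBiprodIso K' L' i).hom =
      biprod.map (HomologicalComplex.homologyMap f i) (HomologicalComplex.homologyMap g i) := by
    apply biprod.hom_ext <;> apply biprod.hom_ext'
    · rw [Category.assoc, Category.assoc, homologyBiprodIso_hom_fst, inl_homologyBiprodIso_inv_assoc,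
        ← HomologicalComplex.homologyMap_comp, ← HomologicalComplex.homologyMap_comp,
        biprod.map_fst, biprod.inl_fst_assoc, biprod.inl_map_assoc, biprod.inl_fst, Category.comp_id]
    · rw [Category.assoc, Category.assoc, homologyBiprodIso_hom_fst, inr_homologyBiprodIso_inv_assoc,
        ← HomologicalComplex.homologyMap_comp, ← HomologicalComplex.homologyMap_comp,
        biprod.map_fst, biprod.inr_fst_assoc, zero_comp, HomologicalComplex.homologyMap_zero,
        biprod.inr_map_assoc, biprod.inr_fst, comp_zero]
    · rw [Category.assoc, Category.assoc, homologyBiprodIso_hom_snd, inl_homologyBiprodIso_inv_assoc,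
        ← HomologicalComplex.homologyMap_comp, ← HomologicalComplex.homologyMap_comp,
        biprod.map_snd, biprod.inl_snd_assoc, zero_comp, HomologicalComplex.homologyMap_zero,
        biprod.inl_map_assoc, biprod.inl_snd, comp_zero]
    · rw [Category.assoc, Category.assoc, homologyBiprodIso_hom_snd, inr_homologyBiprodIso_inv_assoc,
        ← HomologicalComplex.homologyMap_comp, ← HomologicalComplex.homologyMap_comp,
        biprod.map_snd, biprod.inr_snd_assoc, biprod.inr_map_assoc, biprod.inr_snd, Category.comp_id]
  have e' : HomologicalComplex.homologyMap (biprod.map f g) i =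
      (homologyBiprodIso K L i).hom ≫
        biprod.map (HomologicalComplex.homologyMap f i) (HomologicalComplex.homologyMap g i) ≫
          (homologyBiprodIso K' L' i).inv := by
    rw [← e, Category.assoc, Category.assoc, Iso.hom_inv_id, Category.comp_id, Iso.hom_inv_id_assoc]
  haveI : IsIso (biprod.map (HomologicalComplex.homologyMap f i) (HomologicalComplex.homologyMap g i)) := by
    change IsIso (biprod.mapIso (asIso (HomologicalComplex.homologyMap f i))
      (asIso (HomologicalComplex.homologyMap g i))).hom
    infer_instance
  rw [e']
  infer_instance

/-! ### The comparison morphism from the Mayer–Vietoris sequence of all cochains -/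

/-- Restriction to smooth chains on small cochains:
`Hom(C(U) + C(V), N) → Hom(Δ^{sm}(U) + Δ^{sm}(V), N)`. [cite: Bredon1993, §V.9] -/
abbrev toSmoothSup (U V : Set M) :
    dualObj R N (chainsInSub R R M U ⊔ chainsInSub R R M V).toComplex ⟶
      dualObj R N (𝑆 U ⊔ 𝑆 V).toComplex :=
  dualMap R N (Subcomplex.incl (sup_le_sup (smoothChainsInSub_le_chainsInSub (I := I) U)
    (smoothChainsInSub_le_chainsInSub (I := I) V)))

/-- **The Mayer–Vietoris ladder, singular-to-smooth**: restriction of cochains to smooth chains is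
a morphism from the Mayer–Vietoris short exact sequence of all cochains
(`subsetCochains.mvShortComplex`) to that of smooth cochains (Bredon (1993), §V.9, the commutative
ladder in the proof of Thm. V.9.5). [cite: Bredon1993, §V.9] -/
def mvToSmooth (U V : Set M) : subsetCochains.mvShortComplex R N U V ⟶ mvShortComplex I R N U V where
  τ₁ := toSmoothSup I R N U V
  τ₂ := biprod.map (toSmooth I R N U) (toSmooth I R N V)
  τ₃ := toSmooth I R N (U ∩ V)
  comm₁₂ := by
    dsimp only [mvShortComplex, subsetCochains.mvShortComplex]
    apply biprod.hom_ext
    · rw [Category.assoc, biprod.lift_fst, Category.assoc, biprod.map_fst, biprod.lift_fst_assoc,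
        toSmooth, toSmoothSup, ← dualMap_comp, ← dualMap_comp, Subcomplex.incl_comp_incl,
        Subcomplex.incl_comp_incl]
    · rw [Category.assoc, biprod.lift_snd, Category.assoc, biprod.map_snd, biprod.lift_snd_assoc,
        toSmooth, toSmoothSup, ← dualMap_comp, ← dualMap_comp, Subcomplex.incl_comp_incl,
        Subcomplex.incl_comp_incl]
  comm₂₃ := by
    dsimp only [mvShortComplex, subsetCochains.mvShortComplex]
    apply biprod.hom_ext'
    · rw [biprod.inl_map_assoc, biprod.inl_desc, biprod.inl_desc_assoc, res_comp_toSmooth]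
    · rw [biprod.inr_map_assoc, biprod.inr_desc, biprod.inr_desc_assoc, Preadditive.comp_neg,
        Preadditive.neg_comp, res_comp_toSmooth]

/-- The first component of the ladder is restriction to smooth small chains. [folklore] -/
@[simp] lemma mvToSmooth_τ₁ (U V : Set M) : (mvToSmooth I R N U V).τ₁ = toSmoothSup I R N U V := rfl

/-- The second component of the ladder is `toSmooth U ⊞ toSmooth V`. [folklore] -/
@[simp] lemma mvToSmooth_τ₂ (U V : Set M) :
    (mvToSmooth I R N U V).τ₂ = biprod.map (toSmooth I R N U) (toSmooth I R N V) := rfl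

/-- The third component of the ladder is `toSmooth (U ∩ V)`. [folklore] -/
@[simp] lemma mvToSmooth_τ₃ (U V : Set M) : (mvToSmooth I R N U V).τ₃ = toSmooth I R N (U ∩ V) := rfl

/-- Compatibility of the two restrictions to small cochains with `toSmooth`:
`resSup ≫ toSmoothSup = toSmooth (U ∪ V) ≫ resSup`. [folklore] -/
@[reassoc]
theorem resSup_comp_toSmoothSup (U V : Set M) :
    subsetCochains.resSup R N U V ≫ toSmoothSup I R N U V =
      toSmooth I R N (U ∪ V) ≫ resSup I R N U V := by
  rw [subsetCochains.resSup, toSmoothSup, toSmooth, resSup, ← dualMap_comp, ← dualMap_comp,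
    Subcomplex.incl_comp_incl, Subcomplex.incl_comp_incl]

/-- **Mayer–Vietoris step for `toSmooth`** (Bredon (1993), Lemma V.9.4 applied to the ladder of
Thm. V.9.5): if restriction to smooth chains induces isomorphisms on the cohomology of `U`, of `V`
and of `U ∩ V` (all degrees), then it does so on `U ∪ V`, for `U`, `V` open. [cite: Bredon1993, Lemma V.9.4] -/
theorem isIso_homologyMap_toSmooth_union {U V : Set M} (hU : IsOpen U) (hV : IsOpen V)
    (hu : ∀ p, IsIso (HomologicalComplex.homologyMap (toSmooth I R N U) p))
    (hv : ∀ p, IsIso (HomologicalComplex.homologyMap (toSmooth I R N V) p))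
    (huv : ∀ p, IsIso (HomologicalComplex.homologyMap (toSmooth I R N (U ∩ V)) p)) (p : ℕ) :
    IsIso (HomologicalComplex.homologyMap (toSmooth I R N (U ∪ V)) p) := by
  -- the ladder gives the statement for small cochains
  have hsmall : IsIso (HomologicalComplex.homologyMap (toSmoothSup I R N U V) p) := by
    have h := Literature.Algebra.Homology.isIso_homologyMap_τ₁_of_forall (mvToSmooth I R N U V)
      (subsetCochains.mvShortComplex_shortExact R N U V) (mvShortComplex_shortExact I R N U V)
      (fun j => ?_) (fun j => huv j) p
    · exact h
    · haveI := hu j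
      haveI := hv j
      exact isIso_homologyMap_biprod_map R _ _ j
  -- transfer along the two quasi-isomorphisms `resSup`
  haveI := hsmall
  haveI := subsetCochains.isIso_homologyMap_resSup (R := R) (N := N) (X := M) hU hV p
  haveI := isIso_homologyMap_resSup (I := I) (N := N) hU hV p
  have hfac : HomologicalComplex.homologyMap (toSmooth I R N (U ∪ V)) p ≫
      HomologicalComplex.homologyMap (resSup I R N U V) p =
      HomologicalComplex.homologyMap (subsetCochains.resSup R N U V) p ≫
        HomologicalComplex.homologyMap (toSmoothSup I R N U V) p := by
    rw [← HomologicalComplex.homologyMap_comp, ← HomologicalComplex.homologyMap_comp,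
      resSup_comp_toSmoothSup]
  exact IsIso.of_isIso_fac_right hfac

end smoothSubsetCochains

end Cochains

end Literature.Geometry.Manifold
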